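import Literature.MathematicalPhysics.QuantumFieldTheory.Federbush1986.AbelianStability

/-!
# Federbush 1986 — the Abelian Stability inequality LOCALIZED and WEIGHTED, carrier-agnostic: `Σ_{i∈S_c}(A_{∂P_i})² ≤ N^{4−d}·Σ_j ζ_j (A_{∂p_j})²`
# whenever the fine weight `ζ ≥ 0` is `≥ 1` on the stencil of the coarse plaquettes in `S_c`

**Citation header (a refinement of a PUBLISHED inequality; cell pub-ymgap, HUMAN RULING D-0062 ∕ D-0149, seat `pub-ymgap-dag-n12-w4`, lane word
(A) of `pub-ymgap-dag-n12-c` g16; key K1⁷ stmt-QuantumFields-20542, helper, count-neutral).**  P. Federbush, *A phase cell approach to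
Yang–Mills theory. I*, Commun. Math. Phys. **107** (1986) 319–329 [Federbush1986PhaseCellI], p. 321 'Abelian Stability Theorem' (0.12)
«averaging decreases the action», p. 322 (1.3)–(1.4), p. 323 (1.5)–(1.9); P. Federbush, *… III*, Commun. Math. Phys. **110** (1987) 293–309
[Federbush1987PhaseCellIII], §2 (2.1)–(2.5) p. 296.  The tree's `Federbush1986.AbelianStability` (b2b-balaban-t4-lit2) proves the printed
inequality for ARBITRARY block maps `blk : P × T → C` and offset sets `S` (`loopAverage`, `stencilWeight`, the row∕column counts
(1.6)∕(1.5)); `Balaban1983to89.B16Ineq17LocalFederbush` (this seat, p584067) proves the LOCALIZED, WEIGHTED version for Bałaban's typed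
corner-block average `B5Block118.QvOp`.  THIS FILE proves the localized, weighted version in the CARRIER-AGNOSTIC stencil currency, so that
ANY block convention — in particular the CENTRED blocks of `Balaban1983to89.Setup.blockOf` (DIVERGENCE F3: `n ↦ nL + (L−1)∕2`, not B5's corner
`n·y + j`) on NODE 00's fine torus `Site (F.P Kt) 0` — is an instance, with no `ZMod` transport between fine-torus presentations.

WHY (the use; [Balaban1989LargeFieldII] (1.7) p. 358 at flat background, see p584067's header): the lower bound (1.7) needs
`‖∂₁B′‖²_{near Λ} ≤ ⟨A, Δ₁^{flat}(ζ₀)A⟩` for ONE fine field `A` whose block averages reproduce `B′` near `Λ` (the flat linearised minimiser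
of the `Z`-problem) and a cut-off `ζ₀ ≥ 0` that is `≡ 1` near `Λ` — i.e. Federbush's inequality with (i) the coarse sum restricted to a set
`S_c` of coarse plaquettes, (ii) the fine sum weighted by `ζ`, (iii) the datum matched on `S_c` only.  All three are free in Federbush's
own proof ((1.7) is row-by-row; the column count only meets fine plaquettes in the stencil of `S_c`).

**What this file PROVES (kernel, Mathlib + `AbelianStability` only; [folklore] bookkeeping around the cited inequality; no `def`, no `sorry`).**
* §1 `sum_sq_weightedSum_le_local` — the abstract content: non-negative weights `α`, row sums `≤ R` on `i ∈ S_c`, and the WEIGHTED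
  column bound `Σ_{i∈S_c} α i j ≤ C·ζ_j` (this single hypothesis carries both Federbush's column count and the localization: off the
  stencil of `S_c` the left side is `0`); then `Σ_{i∈S_c}(Σ_j α i j·a_j)² ≤ R·C·Σ_j ζ_j·a_j²`.
* §2 `stencilWeight_eq_zero_of_forall_not_mem` (a coarse plaquette `c` gives weight `0` to a fine plaquette `w` unless `w` is reached
  from the block of `c`: `blk (w.1 − s, w.2) = c` for some offset `s ∈ S`), ★ `sum_stencilWeight_col_le_local` — the LOCALIZED
  column bound `Σ_{c∈S_c} α(c)_w ≤ K⁻¹·#S·ζ_w` for `ζ_w ≥ 0`, `ζ_w ≥ 1` whenever `w` lies in the stencil of `S_c`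
  (`∃ s ∈ S, blk (w.1 − s, w.2) ∈ S_c`).
* §3 ★★ `sum_sq_meanLoopAverage_le_local` — B5 normalisation (`η = N⁻¹`, blocks of `N^d` base points, `N²` offsets):
  `Σ_{c∈S_c}(η·loopAverage F c)² ≤ η^{d−2}·Σ_w ζ_w·F_w²`; at `S_c = univ`, `ζ ≡ 1` this is the tree's `sum_sq_meanLoopAverage_le`.
* §4 ★★ `sum_sq_le_of_rightInverse_local` — the fibre ∕ minimiser reading, localized: for ANY `H` whose `η`-normalised loop averages
  reproduce the coarse datum `G` ON `S_c` (any selection, minimising or not — e.g. the plaquette field of the flat linearised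
  `Z`-minimiser, [Balaban1989LargeFieldII] (1.3)), `Σ_{c∈S_c} G(c)² ≤ η^{d−2}·Σ_w ζ_w·(HG)_w²` — «`‖∂₁B′‖² ≤ ⟨A, Δ₁^{flat}(ζ₀)A⟩`,
  γ₀ = 1» for every block convention.

HONEST SCOPE.  Finite bookkeeping (Cauchy–Schwarz row by row, counting) about ABELIAN real plaquette data; the identification of a
concrete average (B5 (1.18) corner blocks: `Balaban1983to89.B5AverageCurlStokes.plaq_QvOp`; NODE 00's centred blocks: not yet typed)
with `loopAverage blk S K` via Stokes is the instance's business, exactly as in the parent file's §8 header.  Not an η-rate, nothing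
non-abelian, nothing about minimisers beyond the displayed right-inverse hypothesis; count-neutral; N12 of the cell's DAG NOT discharged;
NOT summit progress (one finite 𝕋⁴ programme at fixed `ε`; nothing continuum ∕ ℝ⁴ ∕ OS ∕ mass gap ∕ Clay).
-/

namespace Literature.MathematicalPhysics.QuantumFieldTheory.Federbush1986

open Finset

/-! ## §1 The doubly-weighted Cauchy–Schwarz inequality, localized and weighted -/

section Weighted

variable {ι κ : Type*} [Fintype κ]

/-- **FEDERBUSH I (1.7)–(1.8) ∕ III (2.4)–(2.5), LOCALIZED AND WEIGHTED.**  Non-negative weights `α i j` with row sums `Σ_j α i j ≤ R` for the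
coarse indices `i ∈ S_c`, and the weighted column bound `Σ_{i∈S_c} α i j ≤ C·ζ_j` (Federbush's column count `≤ C` where `ζ_j ≥ 1`, i.e. on
the stencil of `S_c`; vacuous where no `i ∈ S_c` meets `j`); then for every real fine datum `a`,
`Σ_{i∈S_c} (Σ_j α i j · a_j)² ≤ R · C · Σ_j ζ_j · a_j²` — row by row «by the Schwarz inequality» ((1.7)), then the column bound ((1.8)).
[cite: Federbush1986PhaseCellI, (1.7)–(1.8) p. 323; Federbush1987PhaseCellIII, (2.4)–(2.5) p. 296] -/
theorem sum_sq_weightedSum_le_local (α : ι → κ → ℝ) (a : κ → ℝ) (Sc : Finset ι) (ζ : κ → ℝ) (R C : ℝ)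
    (hα : ∀ i j, 0 ≤ α i j) (hrow : ∀ i ∈ Sc, ∑ j, α i j ≤ R) (hcol : ∀ j, ∑ i ∈ Sc, α i j ≤ C * ζ j) (hR : 0 ≤ R) :
    ∑ i ∈ Sc, (∑ j, α i j * a j) ^ 2 ≤ R * C * ∑ j, ζ j * a j ^ 2 := by
  -- row by row (1.7)/(2.4)
  have hrows : ∑ i ∈ Sc, (∑ j, α i j * a j) ^ 2 ≤ ∑ i ∈ Sc, R * ∑ j, α i j * a j ^ 2 :=
    Finset.sum_le_sum fun i hi => sq_weightedSum_le_row (α i) a R (hα i) (hrow i hi)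
  -- exchange the sums and use the weighted column bound
  have hswap : ∑ i ∈ Sc, R * ∑ j, α i j * a j ^ 2 = R * ∑ j, (∑ i ∈ Sc, α i j) * a j ^ 2 := by
    rw [← Finset.mul_sum, Finset.sum_comm]
    congr 1
    refine Finset.sum_congr rfl fun j _ => ?_
    rw [Finset.sum_mul]
  have hcols : ∑ j, (∑ i ∈ Sc, α i j) * a j ^ 2 ≤ ∑ j, C * ζ j * a j ^ 2 :=
    Finset.sum_le_sum fun j _ => mul_le_mul_of_nonneg_right (hcol j) (sq_nonneg _)
  calc ∑ i ∈ Sc, (∑ j, α i j * a j) ^ 2 ≤ ∑ i ∈ Sc, R * ∑ j, α i j * a j ^ 2 := hrows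
    _ = R * ∑ j, (∑ i ∈ Sc, α i j) * a j ^ 2 := hswap
    _ ≤ R * ∑ j, C * ζ j * a j ^ 2 := mul_le_mul_of_nonneg_left hcols hR
    _ = R * C * ∑ j, ζ j * a j ^ 2 := by
        have h : ∑ j, C * ζ j * a j ^ 2 = C * ∑ j, ζ j * a j ^ 2 := by
          rw [Finset.mul_sum]
          exact Finset.sum_congr rfl fun j _ => by ring
        rw [h, mul_assoc]

end Weighted

/-! ## §2 The stencil weights of (1.3)∕(1.4), localized: which fine plaquettes a set of coarse plaquettes reaches -/

section Stencil

variable {P T C : Type*} [AddCommGroup P] [DecidableEq P] [Fintype P] [Fintype T] [DecidableEq T]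
  [DecidableEq C]

/-- A coarse plaquette `c` gives weight `0` to the fine plaquette `w` unless `w` is reached from the block of `c` by an offset of `S`:
if `blk (w.1 − s, w.2) ≠ c` for every `s ∈ S`, then `α(c)_w = 0` (the only base point `x` with `(x.1 + s, x.2) = w` is `(w.1 − s, w.2)`).
[cite: Federbush1986PhaseCellI, (1.3)–(1.4) p. 322] -/
theorem stencilWeight_eq_zero_of_forall_not_mem (blk : P × T → C) (S : Finset P) (K : ℝ) (c : C) (w : P × T)
    (h : ∀ s ∈ S, blk (w.1 - s, w.2) ≠ c) : stencilWeight blk S K c w = 0 := by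
  unfold stencilWeight
  rw [Finset.card_eq_zero.mpr, Nat.cast_zero, mul_zero]
  refine Finset.filter_eq_empty_iff.mpr fun xs hxs hw => ?_
  unfold stencilPairs blockOf at hxs
  obtain ⟨hx, hs⟩ := Finset.mem_product.mp hxs
  have hblk : blk xs.1 = c := (Finset.mem_filter.mp hx).2
  unfold stencilShift at hw
  apply h xs.2 hs
  have h1 : w.1 - xs.2 = xs.1.1 := by rw [← hw]; simp
  have h2 : w.2 = xs.1.2 := by rw [← hw]
  rw [h1, h2]
  exact hblk

/-- ★ **THE LOCALIZED COLUMN BOUND**: for a set `S_c` of coarse plaquettes and a fine weight with `ζ_w ≥ 0`, and `ζ_w ≥ 1` whenever `w` lies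
in the stencil of `S_c` (`blk (w.1 − s, w.2) ∈ S_c` for some offset `s ∈ S`), `Σ_{c∈S_c} α(c)_w ≤ K⁻¹·#S·ζ_w` (`K ≥ 0`) — Federbush's
column count (1.5)∕(2.2) `Σ_c α(c)_w = K⁻¹·#S` (`sum_stencilWeight_col`) on the stencil, `0` off it.
[cite: Federbush1986PhaseCellI, (1.5) p. 323; Federbush1987PhaseCellIII, (2.2) p. 296] -/
theorem sum_stencilWeight_col_le_local [Fintype C] (blk : P × T → C) (S : Finset P) {K : ℝ} (hK : 0 ≤ K)
    (Sc : Finset C) (w : P × T) {z : ℝ} (hz0 : 0 ≤ z) (hz1 : (∃ s ∈ S, blk (w.1 - s, w.2) ∈ Sc) → 1 ≤ z) :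
    ∑ c ∈ Sc, stencilWeight blk S K c w ≤ K⁻¹ * (S.card : ℕ) * z := by
  by_cases hst : ∃ s ∈ S, blk (w.1 - s, w.2) ∈ Sc
  · calc ∑ c ∈ Sc, stencilWeight blk S K c w
        ≤ ∑ c, stencilWeight blk S K c w :=
          Finset.sum_le_sum_of_subset_of_nonneg (Finset.subset_univ Sc) fun c _ _ => stencilWeight_nonneg blk S hK c w
      _ = K⁻¹ * (S.card : ℕ) := sum_stencilWeight_col blk S K w
      _ = K⁻¹ * (S.card : ℕ) * 1 := (mul_one _).symm
      _ ≤ K⁻¹ * (S.card : ℕ) * z := mul_le_mul_of_nonneg_left (hz1 hst) (by positivity)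
  · have h0 : ∑ c ∈ Sc, stencilWeight blk S K c w = 0 :=
      Finset.sum_eq_zero fun c hc =>
        stencilWeight_eq_zero_of_forall_not_mem blk S K c w fun s hs hsc => hst ⟨s, hs, hsc ▸ hc⟩
    rw [h0]
    positivity

end Stencil

/-! ## §3 B5 normalisation, localized and weighted -/

section B5Normalisation

variable {P T C : Type*} [AddCommGroup P] [DecidableEq P] [Fintype P] [Fintype T] [DecidableEq T]
  [Fintype C] [DecidableEq C]

/-- ★★ **FEDERBUSH'S ABELIAN STABILITY, B5-NORMALISED, LOCALIZED AND WEIGHTED**, any block map with `N^d`-point blocks and `N²` offsets,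
`N ≥ 1`, `η = N⁻¹`: for a set `S_c` of coarse plaquettes and a fine weight `ζ ≥ 0` that is `≥ 1` on the stencil of `S_c`,
`Σ_{c∈S_c} (η·loopAverage F c)² ≤ η^{d−2}·Σ_w ζ_w·F(w)²` — «averaging decreases the action» with the supports of both sides tracked
(B5∕BIJ85 reading: `‖∂₁(Q_kA)‖²_{S_c} ≤ ⟨A, Δ^{flat}(ζ)A⟩_η`).  At `S_c = univ`, `ζ ≡ 1` this is the parent file's `sum_sq_meanLoopAverage_le`.
[cite: Federbush1986PhaseCellI, 'Abelian Stability Theorem' (0.12) p. 321, (1.3)–(1.9) pp. 322–323; Federbush1987PhaseCellIII, §2 (2.1)–(2.5) p. 296;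
BalabanImbrieJaffe1985, (2.13) p. 304, p. 309] -/
theorem sum_sq_meanLoopAverage_le_local (d : ℕ) {N : ℕ} (hN : 0 < N)
    (blk : P × T → C) (S : Finset P) (hblk : ∀ c, (blockOf blk c).card = N ^ d) (hS : S.card = N ^ 2)
    (Sc : Finset C) (ζ : P × T → ℝ) (hζ0 : ∀ w, 0 ≤ ζ w) (hζ1 : ∀ w, (∃ s ∈ S, blk (w.1 - s, w.2) ∈ Sc) → 1 ≤ ζ w)
    (F : P × T → ℝ) :
    ∑ c ∈ Sc, ((N : ℝ)⁻¹ * loopAverage blk S ((N : ℝ) ^ d) F c) ^ 2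
      ≤ ((N : ℝ)⁻¹) ^ ((d : ℤ) - 2) * ∑ w, ζ w * F w ^ 2 := by
  have hNr : (0 : ℝ) < N := by exact_mod_cast hN
  have hNne : (N : ℝ) ≠ 0 := hNr.ne'
  have hKne : ((N : ℝ) ^ d) ≠ 0 := pow_ne_zero _ hNne
  -- the loop average as a weighted sum, and §1 with R = N², C = N^{2-d}
  have hfun : ∀ c, loopAverage blk S ((N : ℝ) ^ d) F c = ∑ w, stencilWeight blk S ((N : ℝ) ^ d) c w * F w :=
    fun c => loopAverage_eq_sum blk S _ F c
  have h1 : ∑ c ∈ Sc, (∑ w, stencilWeight blk S ((N : ℝ) ^ d) c w * F w) ^ 2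
      ≤ (N : ℝ) ^ 2 * (N : ℝ) ^ (2 - (d : ℤ)) * ∑ w, ζ w * F w ^ 2 := by
    refine sum_sq_weightedSum_le_local (stencilWeight blk S ((N : ℝ) ^ d)) F Sc ζ ((N : ℝ) ^ 2) ((N : ℝ) ^ (2 - (d : ℤ)))
      (fun c w => stencilWeight_nonneg blk S (pow_nonneg hNr.le _) c w) (fun c _ => ?_) (fun w => ?_) (by positivity)
    · rw [sum_stencilWeight_row, hblk c, hS]
      push_cast
      rw [inv_mul_cancel_left₀ hKne]
    · refine (sum_stencilWeight_col_le_local blk S (pow_nonneg hNr.le _) Sc w (hζ0 w) (hζ1 w)).trans (le_of_eq ?_)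
      rw [hS]
      push_cast
      rw [show (2 : ℤ) - (d : ℤ) = ((2 : ℕ) : ℤ) - ((d : ℕ) : ℤ) by norm_num, zpow_sub₀ hNne, zpow_natCast,
        zpow_natCast, div_eq_inv_mul]
  -- N⁻² · N² · N^{2−d} = (N⁻¹)^{d−2}
  have key : ∑ c ∈ Sc, ((N : ℝ)⁻¹ * loopAverage blk S ((N : ℝ) ^ d) F c) ^ 2
      = (N : ℝ)⁻¹ ^ 2 * ∑ c ∈ Sc, (∑ w, stencilWeight blk S ((N : ℝ) ^ d) c w * F w) ^ 2 := by
    rw [Finset.mul_sum]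
    exact Finset.sum_congr rfl fun c _ => by rw [mul_pow, hfun c]
  have hexp : (N : ℝ)⁻¹ ^ 2 * ((N : ℝ) ^ 2 * (N : ℝ) ^ (2 - (d : ℤ))) = (N : ℝ)⁻¹ ^ ((d : ℤ) - 2) := by
    rw [← mul_assoc, ← mul_pow, inv_mul_cancel₀ hNne, one_pow, one_mul, ← zpow_neg_one, ← zpow_mul]
    congr 1
    ring
  rw [key]
  calc (N : ℝ)⁻¹ ^ 2 * ∑ c ∈ Sc, (∑ w, stencilWeight blk S ((N : ℝ) ^ d) c w * F w) ^ 2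
      ≤ (N : ℝ)⁻¹ ^ 2 * ((N : ℝ) ^ 2 * (N : ℝ) ^ (2 - (d : ℤ)) * ∑ w, ζ w * F w ^ 2) :=
        mul_le_mul_of_nonneg_left h1 (by positivity)
    _ = (N : ℝ)⁻¹ ^ 2 * ((N : ℝ) ^ 2 * (N : ℝ) ^ (2 - (d : ℤ))) * ∑ w, ζ w * F w ^ 2 := by ring
    _ = (N : ℝ)⁻¹ ^ ((d : ℤ) - 2) * ∑ w, ζ w * F w ^ 2 := by rw [hexp]

/-- ★★ **THE FIBRE ∕ MINIMISER READING, LOCALIZED** (B5 p. 29 «H_kB is a minimum of ½⟨∂A,∂A⟩ on the hyperplane {A : Q_kA = B, …}»; BIJ85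
(4.1.5) «Q_kH_{k,Ax}B = B»; [Balaban1989LargeFieldII] (1.3): the `Z`-problem fixes the averages on `B_k(Z)` only): for ANY map `H` whose
`η`-normalised loop averages reproduce the coarse datum `G` ON THE COARSE PLAQUETTES OF `S_c` — any selection of one fine plaquette field
with the prescribed averages there, minimising or not — and a fine weight `ζ ≥ 0` that is `≥ 1` on the stencil of `S_c`:
`Σ_{c∈S_c} G(c)² ≤ η^{d−2}·Σ_w ζ_w·(HG)(w)²` — «`‖∂₁B′‖² ≤ ⟨A, Δ₁^{flat}(ζ₀)A⟩`, γ₀ = 1» for every block convention, no decay, no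
gauge condition. [cite: Federbush1986PhaseCellI, 'Abelian Stability Theorem' (0.12) p. 321; BalabanImbrieJaffe1985, (4.1.5) p. 310,
(4.3.1)–(4.3.2) p. 311; Balaban1989LargeFieldII, (1.3) p.357, (1.7) p.358] -/
theorem sum_sq_le_of_rightInverse_local (d : ℕ) {N : ℕ} (hN : 0 < N)
    (blk : P × T → C) (S : Finset P) (hblk : ∀ c, (blockOf blk c).card = N ^ d) (hS : S.card = N ^ 2)
    (Sc : Finset C) (ζ : P × T → ℝ) (hζ0 : ∀ w, 0 ≤ ζ w) (hζ1 : ∀ w, (∃ s ∈ S, blk (w.1 - s, w.2) ∈ Sc) → 1 ≤ ζ w)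
    (H : (C → ℝ) → (P × T → ℝ)) (G : C → ℝ)
    (hH : ∀ c ∈ Sc, (N : ℝ)⁻¹ * loopAverage blk S ((N : ℝ) ^ d) (H G) c = G c) :
    ∑ c ∈ Sc, G c ^ 2 ≤ ((N : ℝ)⁻¹) ^ ((d : ℤ) - 2) * ∑ w, ζ w * (H G) w ^ 2 := by
  calc ∑ c ∈ Sc, G c ^ 2 = ∑ c ∈ Sc, ((N : ℝ)⁻¹ * loopAverage blk S ((N : ℝ) ^ d) (H G) c) ^ 2 :=
        Finset.sum_congr rfl fun c hc => by rw [hH c hc]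
    _ ≤ ((N : ℝ)⁻¹) ^ ((d : ℤ) - 2) * ∑ w, ζ w * (H G) w ^ 2 :=
        sum_sq_meanLoopAverage_le_local d hN blk S hblk hS Sc ζ hζ0 hζ1 (H G)

end B5Normalisation

end Literature.MathematicalPhysics.QuantumFieldTheory.Federbush1986
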